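import Summits.ABC.StewartYu.ArchG3KStepDelta
import HarnessLib

/-!
# Cell abc-stewartyu, rung A1.L (crux r2 `ArchCoreRat`), WP-L.A: the archimedean k-step in Δ-form with a GENERIC MONOMIAL DENOMINATOR
# (ruling R34 / R34-implementation: virtual, α-charged denominators at `S(θ)`)

`Summits/ABC/StewartYu/ArchG3KStepDeltaD.lean` — cell `abc-stewartyu` (HOME `run/shared/lean/pub/abc-stewartyu/`; plan rulings R34 (2026-08-27
17:35:30Z) and «R34 IMPLEMENTATION» (17:38:42Z): denominator-GENERIC pack definitions; seat lp-1 g8).  Theorems on `ArchG3Setup`; no definition,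
no named fact.  Sequel of `ArchG3KStepDelta` (✓): the SAME k-step, with the Liouville denominator of the monomials `∏ⱼ αⱼ^{vᵢⱼ x₁}` taken as a
PARAMETER `Dm` with the clearing obligation `Dm · ∏ⱼ αⱼ^{vᵢⱼ x₁} ∈ ℤ` (`i ∈ B`) as a hypothesis — instead of the closed form
`monDen(α, Dbox·|x₁|)` charged on the θ-box.  At `S(θ)` (one-stage line, R32 (a)) the record supplies the VIRTUAL denominator
`Dm = monDen(α°, ⌈Bv·|x₁|/N⌉)` of the saturated data (seat p5, `ArchG3SatData`), which has an `N`-free cost; `monDen` is the `N = 1` instance.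

* `abs_archφ_pvΔ_le_symm` / `abs_archφ_pvΔ_le_odd` — the VALUE BOUNDS of the k-step (steps 1–4b of `kstep_delta_symm/odd`: Taylor jets at
  the old nodes, growth on the far disc, Hermite at `x₁`, the `f − φ` comparison): `|archφ (pvΔ μ) (a,0) x₁| ≤` the left-hand side of
  `kstep_delta_*`'s `hfinal`, verbatim;
* `exists_int_clear_mul_archφ_zero_of_clear` — `(den₀·Dm)·archφ (pv′) (a,0) x ∈ ℤ` from `den₀·(Hasse_a Rᵢ)(x) ∈ ℤ` and `Dm·∏ⱼαⱼ^{vᵢⱼx} ∈ ℤ`;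
* `kstep_delta_symmD` / `kstep_delta_oddD` — the k-steps with the right-hand side `1/(den₀·Dm)`.

WHAT THIS IS NOT: no change to `ArchG3KStepDelta`'s statements; no choice of `Dm`; no crux moves.

## References
* Yu. V. Nesterenko, LNM 1819 (2003) — §4.2 Lemma 4.3 (4.16)–(4.35) p. 83–90 (the k-step); §3.5 p. 72, §3.4 (3.41)–(3.44) p. 105–107
  (denominators of the monomials over `𝔑`). [Nesterenko2003]
* K. Yu, Acta Math. 211 (2013) — Lemma 5.2. [Yu2013]
-/

noncomputable section

open Finset Polynomial
open Literature.NumberTheory.Transcendental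
open Literature.NumberTheory.Transcendental.CW77.Setup (Tau tauNorm)
open Summit.ABC.StewartYu.ArchJets (jetMaj env jetMaj_le_scaled)
open scoped Nat

namespace Summit.ABC.StewartYu

namespace ArchG3Setup

variable (S : ArchG3Setup) {ι : Type*} (R : ι → ℚ[X]) (v : ι → Fin S.n → ℤ)

/-! ### The value bounds of the k-step -/

/-- From `‖F − φ‖ ≤ ε_c` and `‖F‖ ≤ A`: `|φ| ≤ A + ε_c`. [folklore] -/
private theorem abs_ratCast_le_of_norm_sub_le₃ {u : ℂ} {q : ℚ} {A εc : ℝ} (hA : ‖u‖ ≤ A)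
    (hcmp : ‖u - ((q : ℚ) : ℂ)‖ ≤ εc) : |(q : ℝ)| ≤ A + εc := by
  have h1 : ‖((q : ℚ) : ℂ)‖ ≤ ‖u‖ + ‖u - ((q : ℚ) : ℂ)‖ := by
    calc ‖((q : ℚ) : ℂ)‖ = ‖u - (u - ((q : ℚ) : ℂ))‖ := by rw [sub_sub_cancel]
      _ ≤ ‖u‖ + ‖u - ((q : ℚ) : ℂ)‖ := norm_sub_le u (u - ((q : ℚ) : ℂ))
  have h2 : ‖((q : ℚ) : ℂ)‖ = |(q : ℝ)| := by
    rw [← Complex.ofReal_ratCast, Complex.norm_real, Real.norm_eq_abs]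
  rw [← h2]; linarith

/-- **The VALUE BOUND of the symmetric k-step** (steps 1–4b of `kstep_delta_symm`): under the Δ-invariant at the old nodes `|x| ≤ N` and the
uniform sizes, `|archφ (pvΔ μ) (a,0) x₁| ≤ e^{|γ|N′}·(Hermite value bound) + (comparison at x₁)` — the left-hand side of `kstep_delta_symm`'s
numerical inequality. [cite: Nesterenko2003, §4.2 Lemma 4.3 (4.16)–(4.33), p. 83–90] -/
theorem abs_archφ_pvΔ_le_symm (B : Finset ι) (pv : ι → ℤ) {c : ℤ} (hc : c ≠ 0) (e : Fin S.n → ℤ) {T N N' t : ℕ}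
    (hN' : N' ≤ 3 * N + 2) (ht : 1 ≤ t)
    (hinv : ∀ x : ℤ, |x| ≤ (N : ℤ) → ∀ (a' : ℕ) (μ' : Fin S.n → ℕ), a' + ∑ k, μ' k < T →
      S.archφ R v B (S.pvΔ v pv c e μ') (a', 0) x = 0)
    {a : ℕ} {μ : Fin S.n → ℕ} (haμ : a + (∑ k, μ k) + t ≤ T) (x₁ : ℤ) (hx₁ : |x₁| ≤ (N' : ℤ))
    -- uniform sizes
    {A : Fin S.n → ℝ} (hA : ∀ k, |S.lg k| ≤ A k)
    {Γ : Fin S.n → ℝ} (hΓ0 : ∀ k, 0 ≤ Γ k) (hΓ : ∀ i ∈ B, ∀ k, |(S.zγ (v i) k : ℝ)| ≤ Γ k)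
    {P : ℝ} (hP0 : 0 ≤ P) (hP : ∀ i ∈ B, |(S.pvΔ v pv c e μ i : ℝ)| ≤ P)
    {E : ℝ} (hE : 1 ≤ E) (γ : ℝ)
    {Wd : ℝ} (hWd : ∀ i ∈ B, ∀ z : ℂ, ‖z‖ ≤ (3 * E + 1) * (2 * N + 1) + N → ‖(hw R i a).eval z‖ ≤ Wd)
    {Wn : ℝ} (hWn0 : 0 ≤ Wn)
    (hWn : ∀ i ∈ B, ∀ t₀ < T, ∀ x : ℤ, |x| ≤ 3 * (N : ℤ) + 2 → |(((hasseDeriv t₀ (R i)).eval (x : ℚ) : ℚ) : ℝ)| ≤ Wn)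
    {Lmax : ℝ} (hL0 : 0 ≤ Lmax) (hL : ∀ i ∈ B, |S.Lsum (v i)| ≤ Lmax)
    {V₀ : ℝ} (hV0 : 0 ≤ V₀) (hV₀ : ∀ i ∈ B, |(v i S.j₀ : ℝ)| ≤ V₀)
    (hsmall : V₀ * |S.Λ / (S.b S.j₀ : ℝ)| * (3 * N + 2) ≤ 1)
    {Emax : ℝ} (hEm : ∀ i ∈ B, |S.E (v i) - γ| ≤ Emax) {C : ℝ} (hC : 1 ≤ C) :
    |((S.archφ R v B (S.pvΔ v pv c e μ) ((a, 0) : Tau S.n) x₁ : ℚ) : ℝ)| ≤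
      Real.exp (|γ| * N') *
        (2 * ((2 * N + 1 : ℕ) : ℝ) ^ (t + 1) * t * (20 * Real.exp 1) ^ ((2 * N + 1) * t) *
            ((2 * C) ^ t * Real.exp (|γ| * (N + 1)) *
              ((2 : ℝ) ^ a * Real.exp ((∑ k, A k * Γ k) / C) *
                (B.card * P * Wn * Real.exp (Lmax * N) * (2 * (V₀ * |S.Λ / (S.b S.j₀ : ℝ)| * N))))) +
          B.card * P * Wd * Real.exp (Emax * ((3 * E + 1) * (2 * N + 1) + N)) * (1 / E) ^ ((2 * N + 1) * t)) +
        B.card * P * Wn * Real.exp (Lmax * N') * (2 * (V₀ * |S.Λ / (S.b S.j₀ : ℝ)| * N')) := by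
  set pv' := S.pvΔ v pv c e μ with hpv'
  set f : ℂ → ℂ := S.archF R v B pv' ((a, 0) : Tau S.n) with hf
  set δ : ℝ := |S.Λ / (S.b S.j₀ : ℝ)| with hδ
  have hδ0 : 0 ≤ δ := abs_nonneg _
  have hN0 : (0 : ℝ) ≤ N := Nat.cast_nonneg _
  have haT : a < T := by omega
  -- (2) Taylor jets at the old nodes
  have hsmallN : V₀ * |S.Λ / (S.b S.j₀ : ℝ)| * N ≤ 1 :=
    le_trans (mul_le_mul_of_nonneg_left (by linarith) (mul_nonneg hV0 hδ0)) hsmall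
  have hjet : ∀ x : ℤ, |x| ≤ (N : ℤ) → ∀ σ, σ < t → ‖iteratedDeriv σ f (x : ℂ)‖ ≤
      σ.factorial * ((2 * C) ^ σ * ((2 : ℝ) ^ a * Real.exp ((∑ k, A k * Γ k) / C) *
        (B.card * P * Wn * Real.exp (Lmax * N) * (2 * (V₀ * |S.Λ / (S.b S.j₀ : ℝ)| * N))))) := by
    intro x hx
    exact S.taylor_jets_archF_pvΔ R v B pv hc e ht haμ x hx (hinv x hx) hA hΓ0 hΓ hP0 hP hWn0
      (fun i hi t₀ ht₀ => hWn i hi t₀ ht₀ x (by omega)) hL0 hL hV0 hV₀ hsmallN hC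
  -- (3) growth of the twisted function on the big disc (`∏Γ^0 = 1`)
  have hBG : ∀ z : ℂ, ‖z‖ ≤ (3 * E + 1) * (2 * N + 1) + N →
      ‖Complex.exp (-(γ : ℂ) * z) * f z‖ ≤ B.card * P * Wd * Real.exp (Emax * ((3 * E + 1) * (2 * N + 1) + N)) := by
    intro z hz
    have h := S.norm_exp_mul_archF_le_of_disc R v γ B pv' ((a, 0) : Tau S.n) hz hP (fun i hi => hWd i hi z hz) hΓ hEm
    simpa using h
  -- (4a) Hermite at `x₁`
  have hx₁n : ‖((x₁ : ℤ) : ℂ)‖ ≤ 3 * N + 2 := by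
    rw [Complex.norm_intCast]
    have : (|x₁| : ℝ) ≤ N' := by exact_mod_cast hx₁
    have : ((N' : ℕ) : ℝ) ≤ 3 * N + 2 := by exact_mod_cast hN'
    linarith
  have h2C : 1 ≤ 2 * C := by linarith
  have hε0 : 0 ≤ (2 : ℝ) ^ a * Real.exp ((∑ k, A k * Γ k) / C) *
      (B.card * P * Wn * Real.exp (Lmax * N) * (2 * (V₀ * |S.Λ / (S.b S.j₀ : ℝ)| * N))) := by positivity
  have hF := ArchKStep.norm_le_of_taylor_jets_symm (S.differentiable_archF R v B pv' (a, 0)) (-(γ : ℂ)) N ht h2C hε0 hE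
    hjet hBG hx₁n
  have hγ : ‖-(γ : ℂ)‖ = |γ| := by rw [norm_neg, Complex.norm_real, Real.norm_eq_abs]
  rw [hγ] at hF
  -- the value bound with `e^{|γ| N'}`
  set Aval : ℝ := 2 * ((2 * N + 1 : ℕ) : ℝ) ^ (t + 1) * t * (20 * Real.exp 1) ^ ((2 * N + 1) * t) *
      ((2 * C) ^ t * Real.exp (|γ| * (N + 1)) *
        ((2 : ℝ) ^ a * Real.exp ((∑ k, A k * Γ k) / C) *
          (B.card * P * Wn * Real.exp (Lmax * N) * (2 * (V₀ * |S.Λ / (S.b S.j₀ : ℝ)| * N))))) +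
    B.card * P * Wd * Real.exp (Emax * ((3 * E + 1) * (2 * N + 1) + N)) * (1 / E) ^ ((2 * N + 1) * t) with hAval
  have hWd0 : 0 ≤ B.card * P * Wd * Real.exp (Emax * ((3 * E + 1) * (2 * N + 1) + N)) :=
    le_trans (norm_nonneg _) (hBG 0 (by simp; positivity))
  have hAval0 : 0 ≤ Aval := by rw [hAval]; positivity
  have hexp : Real.exp (|γ| * ‖((x₁ : ℤ) : ℂ)‖) ≤ Real.exp (|γ| * N') := by
    refine Real.exp_le_exp.mpr (mul_le_mul_of_nonneg_left ?_ (abs_nonneg _))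
    rw [Complex.norm_intCast]; exact_mod_cast hx₁
  have hF' : ‖f ((x₁ : ℤ) : ℂ)‖ ≤ Real.exp (|γ| * N') * Aval := hF.trans (mul_le_mul_of_nonneg_right hexp hAval0)
  -- (4b) the comparison at `x₁`
  have hx₁R : |(x₁ : ℝ)| ≤ N' := by exact_mod_cast hx₁
  have hN'R : ((N' : ℕ) : ℝ) ≤ 3 * N + 2 := by exact_mod_cast hN'
  have hsmall₁ : V₀ * |S.Λ / (S.b S.j₀ : ℝ)| * |(x₁ : ℝ)| ≤ 1 :=
    le_trans (mul_le_mul_of_nonneg_left (hx₁R.trans hN'R) (mul_nonneg hV0 hδ0)) hsmall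
  have hcmp0 := S.norm_archF_sub_archφ_le_intCast R v B pv' ((a, 0) : Tau S.n) x₁ hP
    (fun i hi => hWn i hi a haT x₁ (by omega)) hΓ hL hV₀ hsmall₁
  have hcmp : ‖f ((x₁ : ℤ) : ℂ) - ((S.archφ R v B pv' ((a, 0) : Tau S.n) x₁ : ℚ) : ℂ)‖ ≤
      B.card * P * Wn * Real.exp (Lmax * N') * (2 * (V₀ * |S.Λ / (S.b S.j₀ : ℝ)| * N')) := by
    refine hcmp0.trans ?_
    simp only [Finset.prod_const_one, Pi.zero_apply, pow_zero, mul_one]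
    have h1 : Real.exp (Lmax * |(x₁ : ℝ)|) ≤ Real.exp (Lmax * N') :=
      Real.exp_le_exp.mpr (mul_le_mul_of_nonneg_left hx₁R hL0)
    have h2 : 2 * (V₀ * |S.Λ / (S.b S.j₀ : ℝ)| * |(x₁ : ℝ)|) ≤ 2 * (V₀ * |S.Λ / (S.b S.j₀ : ℝ)| * N') :=
      mul_le_mul_of_nonneg_left (mul_le_mul_of_nonneg_left hx₁R (mul_nonneg hV0 hδ0)) (by norm_num)
    exact mul_le_mul (mul_le_mul_of_nonneg_left h1 (by positivity)) h2 (by positivity) (by positivity)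
  have hφ : |((S.archφ R v B pv' ((a, 0) : Tau S.n) x₁ : ℚ) : ℝ)| ≤
      Real.exp (|γ| * N') * Aval + B.card * P * Wn * Real.exp (Lmax * N') * (2 * (V₀ * |S.Λ / (S.b S.j₀ : ℝ)| * N')) :=
    abs_ratCast_le_of_norm_sub_le₃ hF' hcmp
  rw [hAval] at hφ
  exact hφ

/-- **The VALUE BOUND of the odd-node k-step** (steps 1–4b of `kstep_delta_odd`). [cite: Nesterenko2003, §4.2 Lemma 4.3 with the nodes 𝒳_{s,0},
(4.24)–(4.33), p. 84–90] [cite: Yu2013, Lemma 5.2] -/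
theorem abs_archφ_pvΔ_le_odd (B : Finset ι) (pv : ι → ℤ) {c : ℤ} (hc : c ≠ 0) (e : Fin S.n → ℤ) {T m N' t : ℕ}
    (hm : 1 ≤ m) (hN' : N' ≤ 6 * m) (ht : 1 ≤ t)
    (hinv : ∀ x : ℤ, Odd x → |x| ≤ 2 * (m : ℤ) - 1 → ∀ (a' : ℕ) (μ' : Fin S.n → ℕ), a' + ∑ k, μ' k < T →
      S.archφ R v B (S.pvΔ v pv c e μ') (a', 0) x = 0)
    {a : ℕ} {μ : Fin S.n → ℕ} (haμ : a + (∑ k, μ k) + t ≤ T) (x₁ : ℤ) (hx₁ : |x₁| ≤ (N' : ℤ))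
    -- uniform sizes
    {A : Fin S.n → ℝ} (hA : ∀ k, |S.lg k| ≤ A k)
    {Γ : Fin S.n → ℝ} (hΓ0 : ∀ k, 0 ≤ Γ k) (hΓ : ∀ i ∈ B, ∀ k, |(S.zγ (v i) k : ℝ)| ≤ Γ k)
    {P : ℝ} (hP0 : 0 ≤ P) (hP : ∀ i ∈ B, |(S.pvΔ v pv c e μ i : ℝ)| ≤ P)
    {E : ℝ} (hE : 1 ≤ E) (γ : ℝ)
    {Wd : ℝ} (hWd : ∀ i ∈ B, ∀ z : ℂ, ‖z‖ ≤ (12 * E + 6) * m → ‖(hw R i a).eval z‖ ≤ Wd)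
    {Wn : ℝ} (hWn0 : 0 ≤ Wn)
    (hWn : ∀ i ∈ B, ∀ t₀ < T, ∀ x : ℤ, |x| ≤ 6 * (m : ℤ) → |(((hasseDeriv t₀ (R i)).eval (x : ℚ) : ℚ) : ℝ)| ≤ Wn)
    {Lmax : ℝ} (hL0 : 0 ≤ Lmax) (hL : ∀ i ∈ B, |S.Lsum (v i)| ≤ Lmax)
    {V₀ : ℝ} (hV0 : 0 ≤ V₀) (hV₀ : ∀ i ∈ B, |(v i S.j₀ : ℝ)| ≤ V₀)
    (hsmall : V₀ * |S.Λ / (S.b S.j₀ : ℝ)| * (6 * m) ≤ 1)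
    {Emax : ℝ} (hEm : ∀ i ∈ B, |S.E (v i) - γ| ≤ Emax) {C : ℝ} (hC : 1 ≤ C) :
    |((S.archφ R v B (S.pvΔ v pv c e μ) ((a, 0) : Tau S.n) x₁ : ℚ) : ℝ)| ≤
      Real.exp (|γ| * N') *
        (2 * ((2 * m : ℕ) : ℝ) ^ (t + 1) * t * (20 * Real.exp 1) ^ ((2 * m) * t) *
            (2 ^ t * ((2 * C) ^ t * Real.exp (|γ| * (2 * m)) *
              ((2 : ℝ) ^ a * Real.exp ((∑ k, A k * Γ k) / C) *
                (B.card * P * Wn * Real.exp (Lmax * ((2 * m - 1 : ℕ) : ℝ)) *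
                  (2 * (V₀ * |S.Λ / (S.b S.j₀ : ℝ)| * ((2 * m - 1 : ℕ) : ℝ))))))) +
          B.card * P * Wd * Real.exp (Emax * ((12 * E + 6) * m)) * (1 / E) ^ ((2 * m) * t)) +
        B.card * P * Wn * Real.exp (Lmax * N') * (2 * (V₀ * |S.Λ / (S.b S.j₀ : ℝ)| * N')) := by
  set pv' := S.pvΔ v pv c e μ with hpv'
  set f : ℂ → ℂ := S.archF R v B pv' ((a, 0) : Tau S.n) with hf
  set δ : ℝ := |S.Λ / (S.b S.j₀ : ℝ)| with hδ
  have hδ0 : 0 ≤ δ := abs_nonneg _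
  have hm0 : (1 : ℝ) ≤ m := by exact_mod_cast hm
  have haT : a < T := by omega
  set Nold : ℕ := 2 * m - 1 with hNold
  have hNoldZ : ((Nold : ℕ) : ℤ) = 2 * (m : ℤ) - 1 := by rw [hNold]; omega
  have hNoldR : ((Nold : ℕ) : ℝ) ≤ 6 * m := by
    have : ((Nold : ℕ) : ℝ) = 2 * m - 1 := by exact_mod_cast (by rw [hNold]; omega : ((Nold : ℕ) : ℤ) = 2 * (m : ℤ) - 1)
    rw [this]; linarith
  -- (2) Taylor jets at the old (odd) nodes
  have hsmallN : V₀ * |S.Λ / (S.b S.j₀ : ℝ)| * Nold ≤ 1 :=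
    le_trans (mul_le_mul_of_nonneg_left hNoldR (mul_nonneg hV0 hδ0)) hsmall
  have hjet : ∀ x : ℤ, Odd x → |x| ≤ 2 * (m : ℤ) - 1 → ∀ σ, σ < t → ‖iteratedDeriv σ f (x : ℂ)‖ ≤
      σ.factorial * ((2 * C) ^ σ * ((2 : ℝ) ^ a * Real.exp ((∑ k, A k * Γ k) / C) *
        (B.card * P * Wn * Real.exp (Lmax * Nold) * (2 * (V₀ * |S.Λ / (S.b S.j₀ : ℝ)| * Nold))))) := by
    intro x hxo hx
    have hx' : |x| ≤ ((Nold : ℕ) : ℤ) := by rw [hNoldZ]; exact hx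
    exact S.taylor_jets_archF_pvΔ R v B pv hc e ht haμ x hx' (hinv x hxo hx) hA hΓ0 hΓ hP0 hP hWn0
      (fun i hi t₀ ht₀ => hWn i hi t₀ ht₀ x (by omega)) hL0 hL hV0 hV₀ hsmallN hC
  -- (3) growth of the twisted function on the big disc (`∏Γ^0 = 1`)
  have hBG : ∀ z : ℂ, ‖z‖ ≤ (12 * E + 6) * m →
      ‖Complex.exp (-(γ : ℂ) * z) * f z‖ ≤ B.card * P * Wd * Real.exp (Emax * ((12 * E + 6) * m)) := by
    intro z hz
    have h := S.norm_exp_mul_archF_le_of_disc R v γ B pv' ((a, 0) : Tau S.n) hz hP (fun i hi => hWd i hi z hz) hΓ hEm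
    simpa using h
  -- (4a) Hermite at `x₁`
  have hx₁n : ‖((x₁ : ℤ) : ℂ)‖ ≤ 6 * m := by
    rw [Complex.norm_intCast]
    have : (|x₁| : ℝ) ≤ N' := by exact_mod_cast hx₁
    have : ((N' : ℕ) : ℝ) ≤ 6 * m := by exact_mod_cast hN'
    linarith
  have h2C : 1 ≤ 2 * C := by linarith
  have hε0 : 0 ≤ (2 : ℝ) ^ a * Real.exp ((∑ k, A k * Γ k) / C) *
      (B.card * P * Wn * Real.exp (Lmax * Nold) * (2 * (V₀ * |S.Λ / (S.b S.j₀ : ℝ)| * Nold))) := by positivity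
  have hF := ArchKStep.norm_le_of_taylor_jets_odd (S.differentiable_archF R v B pv' (a, 0)) (-(γ : ℂ)) hm ht h2C hε0 hE
    hjet hBG hx₁n
  have hγ : ‖-(γ : ℂ)‖ = |γ| := by rw [norm_neg, Complex.norm_real, Real.norm_eq_abs]
  rw [hγ] at hF
  set Aval : ℝ := 2 * ((2 * m : ℕ) : ℝ) ^ (t + 1) * t * (20 * Real.exp 1) ^ ((2 * m) * t) *
      (2 ^ t * ((2 * C) ^ t * Real.exp (|γ| * (2 * m)) *
        ((2 : ℝ) ^ a * Real.exp ((∑ k, A k * Γ k) / C) *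
          (B.card * P * Wn * Real.exp (Lmax * Nold) * (2 * (V₀ * |S.Λ / (S.b S.j₀ : ℝ)| * Nold)))))) +
    B.card * P * Wd * Real.exp (Emax * ((12 * E + 6) * m)) * (1 / E) ^ ((2 * m) * t) with hAval
  have hWd0 : 0 ≤ B.card * P * Wd * Real.exp (Emax * ((12 * E + 6) * m)) :=
    le_trans (norm_nonneg _) (hBG 0 (by simp; positivity))
  have hAval0 : 0 ≤ Aval := by rw [hAval]; positivity
  have hexp : Real.exp (|γ| * ‖((x₁ : ℤ) : ℂ)‖) ≤ Real.exp (|γ| * N') := by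
    refine Real.exp_le_exp.mpr (mul_le_mul_of_nonneg_left ?_ (abs_nonneg _))
    rw [Complex.norm_intCast]; exact_mod_cast hx₁
  have hF' : ‖f ((x₁ : ℤ) : ℂ)‖ ≤ Real.exp (|γ| * N') * Aval := hF.trans (mul_le_mul_of_nonneg_right hexp hAval0)
  -- (4b) the comparison at `x₁`
  have hx₁R : |(x₁ : ℝ)| ≤ N' := by exact_mod_cast hx₁
  have hN'R : ((N' : ℕ) : ℝ) ≤ 6 * m := by exact_mod_cast hN'
  have hsmall₁ : V₀ * |S.Λ / (S.b S.j₀ : ℝ)| * |(x₁ : ℝ)| ≤ 1 :=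
    le_trans (mul_le_mul_of_nonneg_left (hx₁R.trans hN'R) (mul_nonneg hV0 hδ0)) hsmall
  have hcmp0 := S.norm_archF_sub_archφ_le_intCast R v B pv' ((a, 0) : Tau S.n) x₁ hP
    (fun i hi => hWn i hi a haT x₁ (by omega)) hΓ hL hV₀ hsmall₁
  have hcmp : ‖f ((x₁ : ℤ) : ℂ) - ((S.archφ R v B pv' ((a, 0) : Tau S.n) x₁ : ℚ) : ℂ)‖ ≤
      B.card * P * Wn * Real.exp (Lmax * N') * (2 * (V₀ * |S.Λ / (S.b S.j₀ : ℝ)| * N')) := by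
    refine hcmp0.trans ?_
    simp only [Finset.prod_const_one, Pi.zero_apply, pow_zero, mul_one]
    have h1 : Real.exp (Lmax * |(x₁ : ℝ)|) ≤ Real.exp (Lmax * N') :=
      Real.exp_le_exp.mpr (mul_le_mul_of_nonneg_left hx₁R hL0)
    have h2 : 2 * (V₀ * |S.Λ / (S.b S.j₀ : ℝ)| * |(x₁ : ℝ)|) ≤ 2 * (V₀ * |S.Λ / (S.b S.j₀ : ℝ)| * N') :=
      mul_le_mul_of_nonneg_left (mul_le_mul_of_nonneg_left hx₁R (mul_nonneg hV0 hδ0)) (by norm_num)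
    exact mul_le_mul (mul_le_mul_of_nonneg_left h1 (by positivity)) h2 (by positivity) (by positivity)
  have hφ : |((S.archφ R v B pv' ((a, 0) : Tau S.n) x₁ : ℚ) : ℝ)| ≤
      Real.exp (|γ| * N') * Aval + B.card * P * Wn * Real.exp (Lmax * N') * (2 * (V₀ * |S.Λ / (S.b S.j₀ : ℝ)| * N')) :=
    abs_ratCast_le_of_norm_sub_le₃ hF' hcmp
  rw [hAval] at hφ
  exact hφ

/-! ### The generic clearing of a Δ-value -/

/-- **`(den₀·Dm)·archφ (pv′) (a, 0) x ∈ ℤ`** when `den₀` clears the Hasse values `(Hasse_a Rᵢ)(x)` and `Dm` clears the monomials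
`∏ⱼ αⱼ^{vᵢⱼ x}` (`i ∈ B`) — any denominators. [cite: Nesterenko2003, §3.5 p. 72, §3.4 (3.43)–(3.44) p. 106–107] -/
theorem exists_int_clear_mul_archφ_zero_of_clear (B : Finset ι) (pv' : ι → ℤ) (a : ℕ) (x : ℤ) {den₀ Dm : ℕ}
    (hR : ∀ i ∈ B, ∃ z₀ : ℤ, (den₀ : ℚ) * (hasseDeriv a (R i)).eval (x : ℚ) = z₀)
    (hmon : ∀ i ∈ B, ∃ z₂ : ℤ, (Dm : ℚ) * ∏ j, S.α j ^ (v i j * x) = z₂) :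
    ∃ z : ℤ, ((den₀ * Dm : ℕ) : ℚ) * S.archφ R v B pv' ((a, 0) : Tau S.n) x = z := by
  classical
  have hterm : ∀ i ∈ B, ∃ z : ℤ, ((den₀ * Dm : ℕ) : ℚ) *
      ((pv' i : ℚ) * (hasseDeriv a (R i)).eval (x : ℚ) * S.zγpow v i 0 * ∏ j, S.α j ^ (v i j * x)) = z := by
    intro i hi
    obtain ⟨z₀, hz₀⟩ := hR i hi
    obtain ⟨z₂, hz₂⟩ := hmon i hi
    refine ⟨pv' i * z₀ * z₂, ?_⟩
    rw [S.zγpow_zero]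
    push_cast
    calc (den₀ : ℚ) * (Dm : ℚ) * ((pv' i : ℚ) * (hasseDeriv a (R i)).eval (x : ℚ) * 1 * ∏ j, S.α j ^ (v i j * x))
        = (pv' i : ℚ) * ((den₀ : ℚ) * (hasseDeriv a (R i)).eval (x : ℚ)) * ((Dm : ℚ) * ∏ j, S.α j ^ (v i j * x)) := by ring
      _ = (pv' i : ℚ) * (z₀ : ℚ) * (z₂ : ℚ) := by rw [hz₀, hz₂]
  choose! z hz using hterm
  refine ⟨∑ i ∈ B, z i, ?_⟩
  unfold archφ
  rw [mul_sum]
  push_cast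
  refine sum_congr rfl fun i hi => ?_
  have := hz i hi
  push_cast at this
  exact this

/-! ### The k-steps with a generic monomial denominator -/

/-- **THE SYMMETRIC k-STEP IN Δ-FORM WITH A GENERIC MONOMIAL DENOMINATOR**: as `kstep_delta_symm`, with `Dm·∏ⱼαⱼ^{vᵢⱼx₁} ∈ ℤ` (`i ∈ B`) in
place of `monDen(α, Dbox|x₁|)` and the numerical inequality against `1/(den₀·Dm)`. [cite: Nesterenko2003, §4.2 Lemma 4.3 (4.16)–(4.35),
p. 83–90; §3.4 (3.43)–(3.44), p. 106–107] -/
theorem kstep_delta_symmD (B : Finset ι) (pv : ι → ℤ) {c : ℤ} (hc : c ≠ 0) (e : Fin S.n → ℤ) {T N N' t : ℕ}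
    (hN' : N' ≤ 3 * N + 2) (ht : 1 ≤ t)
    (hinv : ∀ x : ℤ, |x| ≤ (N : ℤ) → ∀ (a' : ℕ) (μ' : Fin S.n → ℕ), a' + ∑ k, μ' k < T →
      S.archφ R v B (S.pvΔ v pv c e μ') (a', 0) x = 0)
    {a : ℕ} {μ : Fin S.n → ℕ} (haμ : a + (∑ k, μ k) + t ≤ T) (x₁ : ℤ) (hx₁ : |x₁| ≤ (N' : ℤ))
    -- uniform sizes
    {A : Fin S.n → ℝ} (hA : ∀ k, |S.lg k| ≤ A k)
    {Γ : Fin S.n → ℝ} (hΓ0 : ∀ k, 0 ≤ Γ k) (hΓ : ∀ i ∈ B, ∀ k, |(S.zγ (v i) k : ℝ)| ≤ Γ k)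
    {P : ℝ} (hP0 : 0 ≤ P) (hP : ∀ i ∈ B, |(S.pvΔ v pv c e μ i : ℝ)| ≤ P)
    {E : ℝ} (hE : 1 ≤ E) (γ : ℝ)
    {Wd : ℝ} (hWd : ∀ i ∈ B, ∀ z : ℂ, ‖z‖ ≤ (3 * E + 1) * (2 * N + 1) + N → ‖(hw R i a).eval z‖ ≤ Wd)
    {Wn : ℝ} (hWn0 : 0 ≤ Wn)
    (hWn : ∀ i ∈ B, ∀ t₀ < T, ∀ x : ℤ, |x| ≤ 3 * (N : ℤ) + 2 → |(((hasseDeriv t₀ (R i)).eval (x : ℚ) : ℚ) : ℝ)| ≤ Wn)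
    {Lmax : ℝ} (hL0 : 0 ≤ Lmax) (hL : ∀ i ∈ B, |S.Lsum (v i)| ≤ Lmax)
    {V₀ : ℝ} (hV0 : 0 ≤ V₀) (hV₀ : ∀ i ∈ B, |(v i S.j₀ : ℝ)| ≤ V₀)
    (hsmall : V₀ * |S.Λ / (S.b S.j₀ : ℝ)| * (3 * N + 2) ≤ 1)
    {Emax : ℝ} (hEm : ∀ i ∈ B, |S.E (v i) - γ| ≤ Emax) {C : ℝ} (hC : 1 ≤ C)
    -- denominators (generic)
    {den₀ : ℕ} (hden₀ : 1 ≤ den₀) (hR : ∀ i ∈ B, ∃ z₀ : ℤ, (den₀ : ℚ) * (hasseDeriv a (R i)).eval (x₁ : ℚ) = z₀)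
    {Dm : ℕ} (hDm : 1 ≤ Dm) (hmon : ∀ i ∈ B, ∃ z₂ : ℤ, (Dm : ℚ) * ∏ j, S.α j ^ (v i j * x₁) = z₂)
    -- the numerical inequality
    (hfinal : Real.exp (|γ| * N') *
        (2 * ((2 * N + 1 : ℕ) : ℝ) ^ (t + 1) * t * (20 * Real.exp 1) ^ ((2 * N + 1) * t) *
            ((2 * C) ^ t * Real.exp (|γ| * (N + 1)) *
              ((2 : ℝ) ^ a * Real.exp ((∑ k, A k * Γ k) / C) *
                (B.card * P * Wn * Real.exp (Lmax * N) * (2 * (V₀ * |S.Λ / (S.b S.j₀ : ℝ)| * N))))) +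
          B.card * P * Wd * Real.exp (Emax * ((3 * E + 1) * (2 * N + 1) + N)) * (1 / E) ^ ((2 * N + 1) * t)) +
        B.card * P * Wn * Real.exp (Lmax * N') * (2 * (V₀ * |S.Λ / (S.b S.j₀ : ℝ)| * N')) <
      1 / ((den₀ * Dm : ℕ) : ℝ)) :
    S.archφ R v B (S.pvΔ v pv c e μ) (a, 0) x₁ = 0 := by
  have hφ := S.abs_archφ_pvΔ_le_symm R v B pv hc e hN' ht hinv haμ x₁ hx₁ hA hΓ0 hΓ hP0 hP hE γ hWd hWn0 hWn hL0 hL hV0 hV₀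
    hsmall hEm hC
  have hD1 : 1 ≤ den₀ * Dm := one_le_mul hden₀ hDm
  have hden := S.exists_int_clear_mul_archφ_zero_of_clear R v B (S.pvΔ v pv c e μ) a x₁ hR hmon
  exact ArchKStep.rat_eq_zero_of_abs_lt hD1 hden (lt_of_le_of_lt hφ hfinal)

/-- **THE ODD-NODE k-STEP IN Δ-FORM WITH A GENERIC MONOMIAL DENOMINATOR**: as `kstep_delta_odd`, denominators as in `kstep_delta_symmD`.
[cite: Nesterenko2003, §4.2 Lemma 4.3 with 𝒳_{s,0}, (4.24)–(4.35), p. 84–90] [cite: Yu2013, Lemma 5.2] -/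
theorem kstep_delta_oddD (B : Finset ι) (pv : ι → ℤ) {c : ℤ} (hc : c ≠ 0) (e : Fin S.n → ℤ) {T m N' t : ℕ}
    (hm : 1 ≤ m) (hN' : N' ≤ 6 * m) (ht : 1 ≤ t)
    (hinv : ∀ x : ℤ, Odd x → |x| ≤ 2 * (m : ℤ) - 1 → ∀ (a' : ℕ) (μ' : Fin S.n → ℕ), a' + ∑ k, μ' k < T →
      S.archφ R v B (S.pvΔ v pv c e μ') (a', 0) x = 0)
    {a : ℕ} {μ : Fin S.n → ℕ} (haμ : a + (∑ k, μ k) + t ≤ T) (x₁ : ℤ) (hx₁ : |x₁| ≤ (N' : ℤ))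
    -- uniform sizes
    {A : Fin S.n → ℝ} (hA : ∀ k, |S.lg k| ≤ A k)
    {Γ : Fin S.n → ℝ} (hΓ0 : ∀ k, 0 ≤ Γ k) (hΓ : ∀ i ∈ B, ∀ k, |(S.zγ (v i) k : ℝ)| ≤ Γ k)
    {P : ℝ} (hP0 : 0 ≤ P) (hP : ∀ i ∈ B, |(S.pvΔ v pv c e μ i : ℝ)| ≤ P)
    {E : ℝ} (hE : 1 ≤ E) (γ : ℝ)
    {Wd : ℝ} (hWd : ∀ i ∈ B, ∀ z : ℂ, ‖z‖ ≤ (12 * E + 6) * m → ‖(hw R i a).eval z‖ ≤ Wd)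
    {Wn : ℝ} (hWn0 : 0 ≤ Wn)
    (hWn : ∀ i ∈ B, ∀ t₀ < T, ∀ x : ℤ, |x| ≤ 6 * (m : ℤ) → |(((hasseDeriv t₀ (R i)).eval (x : ℚ) : ℚ) : ℝ)| ≤ Wn)
    {Lmax : ℝ} (hL0 : 0 ≤ Lmax) (hL : ∀ i ∈ B, |S.Lsum (v i)| ≤ Lmax)
    {V₀ : ℝ} (hV0 : 0 ≤ V₀) (hV₀ : ∀ i ∈ B, |(v i S.j₀ : ℝ)| ≤ V₀)
    (hsmall : V₀ * |S.Λ / (S.b S.j₀ : ℝ)| * (6 * m) ≤ 1)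
    {Emax : ℝ} (hEm : ∀ i ∈ B, |S.E (v i) - γ| ≤ Emax) {C : ℝ} (hC : 1 ≤ C)
    -- denominators (generic)
    {den₀ : ℕ} (hden₀ : 1 ≤ den₀) (hR : ∀ i ∈ B, ∃ z₀ : ℤ, (den₀ : ℚ) * (hasseDeriv a (R i)).eval (x₁ : ℚ) = z₀)
    {Dm : ℕ} (hDm : 1 ≤ Dm) (hmon : ∀ i ∈ B, ∃ z₂ : ℤ, (Dm : ℚ) * ∏ j, S.α j ^ (v i j * x₁) = z₂)
    -- the numerical inequality
    (hfinal : Real.exp (|γ| * N') *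
        (2 * ((2 * m : ℕ) : ℝ) ^ (t + 1) * t * (20 * Real.exp 1) ^ ((2 * m) * t) *
            (2 ^ t * ((2 * C) ^ t * Real.exp (|γ| * (2 * m)) *
              ((2 : ℝ) ^ a * Real.exp ((∑ k, A k * Γ k) / C) *
                (B.card * P * Wn * Real.exp (Lmax * ((2 * m - 1 : ℕ) : ℝ)) *
                  (2 * (V₀ * |S.Λ / (S.b S.j₀ : ℝ)| * ((2 * m - 1 : ℕ) : ℝ))))))) +
          B.card * P * Wd * Real.exp (Emax * ((12 * E + 6) * m)) * (1 / E) ^ ((2 * m) * t)) +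
        B.card * P * Wn * Real.exp (Lmax * N') * (2 * (V₀ * |S.Λ / (S.b S.j₀ : ℝ)| * N')) <
      1 / ((den₀ * Dm : ℕ) : ℝ)) :
    S.archφ R v B (S.pvΔ v pv c e μ) (a, 0) x₁ = 0 := by
  have hφ := S.abs_archφ_pvΔ_le_odd R v B pv hc e hm hN' ht hinv haμ x₁ hx₁ hA hΓ0 hΓ hP0 hP hE γ hWd hWn0 hWn hL0 hL hV0 hV₀
    hsmall hEm hC
  have hD1 : 1 ≤ den₀ * Dm := one_le_mul hden₀ hDm
  have hden := S.exists_int_clear_mul_archφ_zero_of_clear R v B (S.pvΔ v pv c e μ) a x₁ hR hmon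
  exact ArchKStep.rat_eq_zero_of_abs_lt hD1 hden (lt_of_le_of_lt hφ hfinal)

end ArchG3Setup

end Summit.ABC.StewartYu

end
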